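import Mathlib.MeasureTheory.Covering.Vitali
import Mathlib.MeasureTheory.Covering.DensityTheorem
import Mathlib.MeasureTheory.Measure.Lebesgue.EqHaar
import Mathlib.MeasureTheory.Integral.Average
import Mathlib.MeasureTheory.Function.LocallyIntegrable
import Mathlib.MeasureTheory.Constructions.Polish.Basic
import Mathlib.Analysis.SpecificLimits.Basic
import HarnessLib

/-!
# The Calderón–Zygmund decomposition (Stein 1970, Ch. I §3, Theorem 4 and its Corollary)

Analysis/SingularIntegrals file 2 of the Calderón–Zygmund `L^p` theory vendored for the discharge
of `Literature.Analysis.FluidPDE.stein1970_normalisedPressure_Lp_bound` (Stein 1970, Ch. II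
§4.2 Theorem 3). Everything here is PROVED.

**Stein 1970, Ch. I §3.2 Theorem 4 / §3.4 Corollary.** *Let `f ≥ 0` be integrable on `ℝⁿ` and
`α > 0`. Then `ℝⁿ = F ∪ Ω`, `F ∩ Ω = ∅`, `f ≤ α` a.e. on `F`, `Ω = ⋃ Q_k` a union of cubes with
disjoint interiors with `α < |Q_k|⁻¹ ∫_{Q_k} f ≤ 2ⁿ α`; consequently `m(Ω) ≤ α⁻¹ ‖f‖₁`.* In the
proof of Ch. II §2 Theorem 1 (§2.4.1, (10)–(11)) this is consumed as the splitting `f = g + b`,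
`b = Σ b_j`: `|g| ≤ Cα` a.e., `‖g‖₁ ≤ ‖f‖₁`, `b_j` supported in (a fixed dilate of) the `j`-th
piece, `∫ b_j = 0`, `Σ ‖b_j‖₁ ≤ C ‖f‖₁`, `Σ m(pieces) ≤ C α⁻¹ ‖f‖₁`; this file proves exactly that
splitting (`exists_calderonZygmund_decomposition`).

## Rendering (design notes): balls instead of dyadic cubes

We run the stopping-time argument with **balls, the Vitali covering lemma and Lebesgue's
differentiation theorem** in place of Stein's dyadic mesh (as the tree's `BMOJohnNirenberg` does
for the John–Nirenberg inequality), on any finite-dimensional real normed space `E` with an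
additive Haar measure `μ` (`n = dim E ≥ 1`):

* top scale `R₀`: `∫_{B̄(x,s)} |f| ≤ α μ(B̄(x,s))` for all `s ≥ R₀` (`exists_radius_integral_le`);
* stopping radius `s_x = R₀ 2^{-j_x}`, `j_x ≥ 1` the first dyadic index with
  `α μ(B̄(x,s_x)) < ∫_{B̄(x,s_x)} |f|`; then `∫_{B̄(x,2^m s_x)} |f| ≤ α μ(B̄(x, 2^m s_x))` for all
  `m ≥ 1`; by Lebesgue differentiation a.e. point of `{|f| > α}` has a stopping radius;
* Vitali (`Vitali.exists_disjoint_subfamily_covering_enlargement_closedBall`, factor `4`): disjoint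
  stopping balls `B_i = B̄(c_i, r_i)` whose enlargements `B_i* = B̄(c_i, 4r_i)` cover `{|f| > α}`
  a.e.; `α Σ μ(B_i) < Σ ∫_{B_i}|f| ≤ ‖f‖₁` and `∫_{B_i*}|f| ≤ α μ(B_i*) = 4ⁿ α μ(B_i)`;
* disjointification keeping `B_i ⊆ Q_i ⊆ B_i*`:
  `Q_i = B_i ∪ ((B_i* ∖ ⋃ B) ∖ ⋃_{i' ≺ i} B_{i'}*)` (`≺` from an injection into `ℕ`), pairwise
  disjoint with `⋃ Q_i = ⋃ B_i* =: Ω`;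
* `m_i = μ(B_i)⁻¹ ∫_{Q_i} f` (so `|m_i| ≤ 4ⁿα`), `b_i = f·1_{Q_i} - m_i·1_{B_i}` (supported in
  `Q_i`, mean zero, `‖b_i‖₁ ≤ 2∫_{Q_i}|f|`), `g = f·1_{Ωᶜ} + Σ m_i 1_{B_i}`, so `f - g = Σ b_i`
  pointwise, `|g| ≤ 4ⁿα` a.e., `|g| ≤ max(|f|, 4ⁿα)` everywhere, `‖g‖₁ ≤ ‖f‖₁`, and `g`
  inherits compact support from `f`.

The constants (`4ⁿ`, `2`, enlargement `4`) replace Stein's (`2ⁿ`, cubes `Q_k`, dilate `2√n`);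
nothing downstream depends on their values beyond being dimensional.

## Mathlib

`Vitali.exists_disjoint_subfamily_covering_enlargement_closedBall`,
`IsUnifLocDoublingMeasure.ae_tendsto_average`, `Measure.addHaar_closedBall_mul`,
`Set.PairwiseDisjoint.countable_of_nonempty_interior`, `Measurable.tsum`,
`MeasureTheory.lintegral_iUnion`, `MeasureTheory.lintegral_tsum` (all used). No Calderón–Zygmund
decomposition in Mathlib at this pin.

## References

* E. M. Stein, *Singular integrals and differentiability properties of functions*, Princeton
  Math. Series 30 (1970): Ch. I §3.2 Theorem 4, §3.3 (proof), §3.4 Corollary; Ch. II §2.4.1,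
  (10)–(11). [`Stein1971`]
* A. P. Calderón, A. Zygmund, *On the existence of certain singular integrals*, Acta Math. 88
  (1952) 85–139, Lemma 1 (the original decomposition).
-/

noncomputable section

open MeasureTheory Metric Set Filter Function
open scoped ENNReal NNReal Topology

namespace Literature.Analysis.SingularIntegrals

universe u

variable {E : Type u} [NormedAddCommGroup E] [NormedSpace ℝ E] [FiniteDimensional ℝ E]
  [MeasurableSpace E] [BorelSpace E] (μ : Measure E) [μ.IsAddHaarMeasure]

/-! ### Balls and the top scale -/

omit [BorelSpace E] in
/-- Closed balls of positive radius have positive (real) Haar measure. [folklore] -/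
theorem measureReal_closedBall_pos (x : E) {r : ℝ} (hr : 0 < r) : 0 < μ.real (closedBall x r) :=
  ENNReal.toReal_pos (measure_closedBall_pos μ x hr).ne' measure_closedBall_lt_top.ne

/-- Scaling of Haar measure on closed balls (real form): `μ(B̄(x, t r)) = tⁿ μ(B̄(x, r))`. [folklore] -/
theorem measureReal_closedBall_mul (x : E) {t r : ℝ} (ht : 0 ≤ t) (hr : 0 ≤ r) :
    μ.real (closedBall x (t * r)) = t ^ Module.finrank ℝ E * μ.real (closedBall x r) := by
  rw [Measure.addHaar_real_closedBall' μ x (mul_nonneg ht hr), Measure.addHaar_real_closedBall' μ x hr,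
    mul_pow]
  ring

/-- Scaling of Haar measure on closed balls: `μ(B̄(x, t r)) = tⁿ μ(B̄(x, r))`. [folklore] -/
theorem measure_closedBall_mul (x : E) {t r : ℝ} (ht : 0 ≤ t) (hr : 0 ≤ r) :
    μ (closedBall x (t * r)) = ENNReal.ofReal (t ^ Module.finrank ℝ E) * μ (closedBall x r) := by
  rw [Measure.addHaar_closedBall_mul μ x ht hr, Measure.addHaar_closedBall_center μ x]

/-- **Top scale** (Stein 1970, Ch. I §3.3, "a mesh of equal cubes whose common diameter is so
large that `|Q'|⁻¹∫_{Q'} f ≤ α`"): for integrable `f` and `α > 0` there is `R₀ > 0` with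
`∫_{B̄(x,s)} |f| ≤ α μ(B̄(x,s))` for every centre `x` and every radius `s ≥ R₀`. [cite: Stein1971, Ch. I §3.3] -/
theorem exists_radius_integral_le [Nontrivial E] {f : E → ℝ} (hf : Integrable f μ) {α : ℝ}
    (hα : 0 < α) :
    ∃ R₀ : ℝ, 0 < R₀ ∧ ∀ (x : E) (s : ℝ), R₀ ≤ s →
      ∫ y in closedBall x s, |f y| ∂μ ≤ α * μ.real (closedBall x s) := by
  set v : ℝ := μ.real (closedBall (0 : E) 1) with hv_def
  have hv : 0 < v := measureReal_closedBall_pos μ 0 one_pos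
  set N : ℝ := ∫ y, |f y| ∂μ with hN_def
  refine ⟨max 1 (N / (α * v)), lt_max_of_lt_left one_pos, fun x s hs => ?_⟩
  have hs1 : 1 ≤ s := le_trans (le_max_left _ _) hs
  have hs0 : 0 ≤ s := zero_le_one.trans hs1
  have hN : ∫ y in closedBall x s, |f y| ∂μ ≤ N :=
    setIntegral_le_integral hf.abs (Eventually.of_forall fun y => abs_nonneg _)
  have hball : μ.real (closedBall x s) = s ^ Module.finrank ℝ E * v :=
    Measure.addHaar_real_closedBall' μ x hs0
  have hsn : N / (α * v) ≤ s ^ Module.finrank ℝ E :=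
    le_trans (le_trans (le_max_right _ _) hs) (le_self_pow₀ hs1 Module.finrank_pos.ne')
  calc ∫ y in closedBall x s, |f y| ∂μ ≤ N := hN
    _ = α * v * (N / (α * v)) := by field_simp
    _ ≤ α * v * s ^ Module.finrank ℝ E := by gcongr
    _ = α * μ.real (closedBall x s) := by rw [hball]; ring

/-! ### The decomposition -/

/-- **The Calderón–Zygmund decomposition** (Stein 1970, Ch. I §3.2 Theorem 4 with §3.4
Corollary, in the form consumed by Ch. II §2.4.1 (10)–(11); balls instead of dyadic cubes, see
the module docstring). Let `μ` be an additive Haar measure on a finite-dimensional real normed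
space `E` of dimension `n ≥ 1`, `f : E → ℝ` measurable and integrable, `α > 0`. Then there are
countably many balls `B̄(cᵢ, rᵢ)` and functions `g`, `bᵢ` with: `Σ μ(B̄(cᵢ,rᵢ)) ≤ α⁻¹ ‖f‖₁`;
`g` measurable and integrable, `|g| ≤ 4ⁿα` a.e., `|g| ≤ max(|f|, 4ⁿα)` everywhere, `‖g‖₁ ≤ ‖f‖₁`,
compactly supported if `f` is; `bᵢ` measurable, integrable, supported in `B̄(cᵢ, 4rᵢ)`, of mean
zero, `Σ ‖bᵢ‖₁ ≤ 2‖f‖₁`; and `f = g + Σᵢ bᵢ` pointwise. [cite: Stein1971, Ch. I §3.2 Thm 4] -/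
theorem exists_calderonZygmund_decomposition [Nontrivial E] {f : E → ℝ} (hfm : Measurable f)
    (hfi : Integrable f μ) {α : ℝ} (hα : 0 < α) :
    ∃ (ι : Type u) (_ : Countable ι) (c : ι → E) (r : ι → ℝ) (g : E → ℝ) (b : ι → E → ℝ),
      (∀ i, 0 < r i) ∧
      (∑' i, μ (closedBall (c i) (r i)) ≤ (ENNReal.ofReal α)⁻¹ * ∫⁻ x, ‖f x‖ₑ ∂μ) ∧
      Measurable g ∧ Integrable g μ ∧
      (∀ᵐ x ∂μ, |g x| ≤ 4 ^ Module.finrank ℝ E * α) ∧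
      (∀ x, |g x| ≤ max |f x| (4 ^ Module.finrank ℝ E * α)) ∧
      (∫⁻ x, ‖g x‖ₑ ∂μ ≤ ∫⁻ x, ‖f x‖ₑ ∂μ) ∧
      (HasCompactSupport f → HasCompactSupport g) ∧
      (∀ i, Measurable (b i)) ∧ (∀ i, Integrable (b i) μ) ∧
      (∀ i, support (b i) ⊆ closedBall (c i) (4 * r i)) ∧
      (∀ i, ∫ x, b i x ∂μ = 0) ∧
      (∑' i, ∫⁻ x, ‖b i x‖ₑ ∂μ ≤ 2 * ∫⁻ x, ‖f x‖ₑ ∂μ) ∧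
      (∀ x, HasSum (fun i => b i x) (f x - g x)) := by
  classical
  set n : ℕ := Module.finrank ℝ E with hn
  obtain ⟨R₀, hR₀, htop⟩ := exists_radius_integral_le μ hfi hα
  /- integrals and volumes of balls -/
  set I : E → ℝ → ℝ := fun x s => ∫ y in closedBall x s, |f y| ∂μ with hI
  set V : E → ℝ → ℝ := fun x s => μ.real (closedBall x s) with hV
  have hVpos : ∀ (x : E) {s : ℝ}, 0 < s → 0 < V x s := fun x s hs => measureReal_closedBall_pos μ x hs
  have hIf : ∀ (x : E) (s : ℝ), IntegrableOn f (closedBall x s) μ := fun x s => hfi.integrableOn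
  have hIabs : ∀ (x : E) (s : ℝ), IntegrableOn (fun y => |f y|) (closedBall x s) μ :=
    fun x s => hfi.abs.integrableOn
  /- dyadic radii -/
  set ρ : ℕ → ℝ := fun j => R₀ / 2 ^ j with hρ
  have hρ0 : ∀ j, 0 < ρ j := fun j => by positivity
  have hρ_tendsto : Tendsto ρ atTop (𝓝[>] 0) := by
    rw [tendsto_nhdsWithin_iff]
    refine ⟨?_, Eventually.of_forall fun j => hρ0 j⟩
    have h : Tendsto (fun j : ℕ => R₀ * (2⁻¹ : ℝ) ^ j) atTop (𝓝 (R₀ * 0)) :=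
      (tendsto_pow_atTop_nhds_zero_of_lt_one (by norm_num) (by norm_num)).const_mul R₀
    rw [mul_zero] at h
    refine h.congr fun j => ?_
    simp only [hρ, inv_pow, div_eq_mul_inv]
  /- the stopping predicate and the stopping radius -/
  set P : E → ℕ → Prop := fun x j => 1 ≤ j ∧ α * V x (ρ j) < I x (ρ j) with hP
  set t : Set E := {x | ∃ j, P x j} with ht_def
  set jx : E → ℕ := fun x => if h : ∃ j, P x j then Nat.find h else 0 with hjx_def
  set s : E → ℝ := fun x => ρ (jx x) with hs_def
  have hs_pos : ∀ x, 0 < s x := fun x => hρ0 _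
  have hjx : ∀ x ∈ t, P x (jx x) := by
    intro x hx
    have hx' : ∃ j, P x j := hx
    simp only [hjx_def, dif_pos hx']
    exact Nat.find_spec hx'
  have hjx1 : ∀ x ∈ t, 1 ≤ jx x := fun x hx => (hjx x hx).1
  have hstop : ∀ x ∈ t, α * V x (s x) < I x (s x) := fun x hx => (hjx x hx).2
  have hjx_min : ∀ x ∈ t, ∀ j, 1 ≤ j → j < jx x → I x (ρ j) ≤ α * V x (ρ j) := by
    intro x hx j hj1 hj
    have hx' : ∃ j, P x j := hx
    have hj' : j < Nat.find hx' := by simpa only [hjx_def, dif_pos hx'] using hj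
    have := Nat.find_min hx' hj'
    simp only [hP, not_and, not_lt] at this
    exact this hj1
  have hs_le : ∀ x ∈ t, s x ≤ R₀ / 2 := by
    intro x hx
    simp only [hs_def, hρ]
    gcongr
    calc (2 : ℝ) = 2 ^ 1 := by norm_num
      _ ≤ 2 ^ jx x := pow_le_pow_right₀ one_le_two (hjx1 x hx)
  -- enlarged stopping balls carry small mass: `I(x, 2^m s_x) ≤ α V(x, 2^m s_x)` for `m ≥ 1`
  have hsmall : ∀ x ∈ t, ∀ m : ℕ, 1 ≤ m → I x (2 ^ m * s x) ≤ α * V x (2 ^ m * s x) := by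
    intro x hx m hm
    by_cases hmj : m < jx x
    · have heq : 2 ^ m * s x = ρ (jx x - m) := by
        simp only [hs_def, hρ]
        rw [pow_sub₀ _ two_ne_zero hmj.le]
        field_simp
      rw [heq]
      exact hjx_min x hx (jx x - m) (by omega) (by omega)
    · rw [not_lt] at hmj
      refine htop x _ ?_
      simp only [hs_def, hρ]
      rw [mul_div_assoc', le_div_iff₀ (by positivity)]
      have h2 : (2 : ℝ) ^ jx x ≤ 2 ^ m := pow_le_pow_right₀ one_le_two hmj
      nlinarith
  have hsmall4 : ∀ x ∈ t, I x (4 * s x) ≤ α * V x (4 * s x) := by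
    intro x hx
    have := hsmall x hx 2 (by norm_num)
    norm_num at this
    exact this
  /- Lebesgue differentiation: a.e. point of `{|f| > α}` is a stopping point -/
  have hLeb : ∀ᵐ x ∂μ, Tendsto (fun j => ⨍ y in closedBall x (ρ j), |f y| ∂μ) atTop (𝓝 |f x|) := by
    have hli : LocallyIntegrable (fun y => |f y|) μ := hfi.abs.locallyIntegrable
    filter_upwards [IsUnifLocDoublingMeasure.ae_tendsto_average μ hli 1] with x hx
    exact hx (fun _ => x) ρ hρ_tendsto (Eventually.of_forall fun j => by
      rw [one_mul]; exact mem_closedBall_self (hρ0 j).le)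
  have hcov : ∀ᵐ x ∂μ, α < |f x| → x ∈ t := by
    filter_upwards [hLeb] with x hx hfx
    have hev : ∀ᶠ j in atTop, α < ⨍ y in closedBall x (ρ j), |f y| ∂μ := hx.eventually (lt_mem_nhds hfx)
    obtain ⟨j, hj, hj1⟩ := (hev.and (eventually_ge_atTop 1)).exists
    refine ⟨j, hj1, ?_⟩
    rw [setAverage_eq, smul_eq_mul, lt_inv_mul_iff₀ (hVpos x (hρ0 j))] at hj
    simpa only [mul_comm] using hj
  /- Vitali -/
  obtain ⟨u, hut, hdisj, hcover⟩ :=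
    Vitali.exists_disjoint_subfamily_covering_enlargement_closedBall t (fun a : E => a) s (R₀ / 2)
      hs_le 4 (by norm_num)
  have hu_count : u.Countable :=
    hdisj.countable_of_nonempty_interior fun a _ =>
      ⟨a, ball_subset_interior_closedBall (mem_ball_self (hs_pos a))⟩
  haveI : Countable u := hu_count.to_subtype
  obtain ⟨e, he⟩ := Countable.exists_injective_nat u
  /- the balls -/
  set B : u → Set E := fun i => closedBall (i : E) (s i) with hB
  set Bs : u → Set E := fun i => closedBall (i : E) (4 * s i) with hBs
  set UB : Set E := ⋃ i, B i with hUB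
  set Ω : Set E := ⋃ i, Bs i with hΩ
  have hBmeas : ∀ i, MeasurableSet (B i) := fun i => measurableSet_closedBall
  have hBsmeas : ∀ i, MeasurableSet (Bs i) := fun i => measurableSet_closedBall
  have hUBmeas : MeasurableSet UB := MeasurableSet.iUnion hBmeas
  have hΩmeas : MeasurableSet Ω := MeasurableSet.iUnion hBsmeas
  have hB_sub_Bs : ∀ i, B i ⊆ Bs i := fun i =>
    closedBall_subset_closedBall (by linarith [hs_pos (i : E)])
  have hUB_sub_Ω : UB ⊆ Ω := iUnion_mono hB_sub_Bs
  have hBdisj : Pairwise (Disjoint on B) := fun i j hij =>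
    hdisj i.2 j.2 (fun h => hij (Subtype.ext h))
  have hit : ∀ i : u, (i : E) ∈ t := fun i => hut i.2
  -- mass bounds on the balls
  have hB_lower : ∀ i : u, α * V (i : E) (s i) < I (i : E) (s i) := fun i => hstop (i : E) (hit i)
  have hBs_upper : ∀ i : u, I (i : E) (4 * s i) ≤ α * (4 ^ n * V (i : E) (s i)) := by
    intro i
    have h := hsmall4 (i : E) (hit i)
    have e4 : V (i : E) (4 * s i) = 4 ^ n * V (i : E) (s i) :=
      measureReal_closedBall_mul μ (i : E) (by norm_num : (0 : ℝ) ≤ 4) (hs_pos _).le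
    rwa [e4] at h
  /- a.e. covering of the level set -/
  have hlevel : ∀ᵐ x ∂μ, x ∉ Ω → |f x| ≤ α := by
    filter_upwards [hcov] with x hx hxΩ
    by_contra hfx
    rw [not_le] at hfx
    obtain ⟨b', hb'u, hsub⟩ := hcover x (hx hfx)
    exact hxΩ (mem_iUnion.2 ⟨⟨b', hb'u⟩, hsub (mem_closedBall_self (hs_pos x).le)⟩)
  /- disjointification `B i ⊆ Q i ⊆ Bs i` -/
  set Q : u → Set E := fun i => B i ∪ ((Bs i \ UB) \ ⋃ i' ∈ {i' : u | e i' < e i}, Bs i') with hQ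
  have hQmeas : ∀ i, MeasurableSet (Q i) := fun i =>
    (hBmeas i).union (((hBsmeas i).diff hUBmeas).diff
      (MeasurableSet.biUnion (Set.to_countable _) fun i' _ => hBsmeas i'))
  have hB_sub_Q : ∀ i, B i ⊆ Q i := fun i => subset_union_left
  have hQ_sub_Bs : ∀ i, Q i ⊆ Bs i := fun i =>
    union_subset (hB_sub_Bs i) fun x hx => hx.1.1
  have hQdisj : Pairwise (Disjoint on Q) := by
    intro i j hij
    have hne : e i ≠ e j := fun h => hij (he h)
    -- it suffices to treat `e i < e j`
    suffices key : ∀ i j : u, e i < e j → Disjoint (Q i) (Q j) by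
      rcases lt_or_gt_of_ne hne with h | h
      · exact key i j h
      · exact (key j i h).symm
    intro i j h
    rw [Set.disjoint_iff]
    rintro x ⟨hxi, hxj⟩
    have hij' : i ≠ j := fun h' => (lt_irrefl _) (h' ▸ h)
    rcases hxi with hxi | hxi <;> rcases hxj with hxj | hxj
    · exact (Set.disjoint_iff.1 (hBdisj hij')) ⟨hxi, hxj⟩
    · exact hxj.1.2 (mem_iUnion.2 ⟨i, hxi⟩)
    · exact hxi.1.2 (mem_iUnion.2 ⟨j, hxj⟩)
    · exact hxj.2 (mem_biUnion (show i ∈ {i' : u | e i' < e j} from h) hxi.1.1)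
  have hQunion : (⋃ i, Q i) = Ω := by
    refine Subset.antisymm (iUnion_mono hQ_sub_Bs) fun x hx => ?_
    by_cases hxUB : x ∈ UB
    · obtain ⟨i, hi⟩ := mem_iUnion.1 hxUB
      exact mem_iUnion.2 ⟨i, hB_sub_Q i hi⟩
    · -- the `e`-minimal enlarged ball containing `x`
      have hexk : ∃ k : ℕ, ∃ i : u, e i = k ∧ x ∈ Bs i := by
        obtain ⟨i, hi⟩ := mem_iUnion.1 hx
        exact ⟨e i, i, rfl, hi⟩
      obtain ⟨i₀, hi₀e, hi₀x⟩ := Nat.find_spec hexk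
      refine mem_iUnion.2 ⟨i₀, Or.inr ⟨⟨hi₀x, hxUB⟩, fun hx' => ?_⟩⟩
      rw [mem_iUnion₂] at hx'
      obtain ⟨i', hi', hxi'⟩ := hx'
      have hlt : e i' < Nat.find hexk := by rw [← hi₀e]; exact hi'
      exact Nat.find_min hexk hlt ⟨i', rfl, hxi'⟩
  have hQ_unique : ∀ {x : E} {i j : u}, x ∈ Q i → x ∈ Q j → i = j := fun hxi hxj =>
    hQdisj.eq (Set.not_disjoint_iff.2 ⟨_, hxi, hxj⟩)
  have hB_unique : ∀ {x : E} {i j : u}, x ∈ B i → x ∈ B j → i = j := fun hxi hxj =>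
    hBdisj.eq (Set.not_disjoint_iff.2 ⟨_, hxi, hxj⟩)
  /- the compensating constants `m i = μ(B i)⁻¹ ∫_{Q i} f` -/
  set m : u → ℝ := fun i => (V i (s i))⁻¹ * ∫ y in Q i, f y ∂μ with hm
  have hIQ_le : ∀ i, ∫ y in Q i, |f y| ∂μ ≤ α * (4 ^ n * V i (s i)) := fun i =>
    (setIntegral_mono_set (hIabs i _) (Eventually.of_forall fun y => abs_nonneg _)
      (Eventually.of_forall (hQ_sub_Bs i))).trans (hBs_upper i)
  have hm_abs_mul : ∀ i, |m i| * V i (s i) ≤ ∫ y in Q i, |f y| ∂μ := by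
    intro i
    have hV0 := hVpos (i : E) (hs_pos i)
    have : |m i| * V i (s i) = |∫ y in Q i, f y ∂μ| := by
      simp only [hm, abs_mul, abs_inv, abs_of_pos hV0]
      field_simp
    rw [this]
    exact abs_integral_le_integral_abs
  have hm_abs : ∀ i, |m i| ≤ 4 ^ n * α := by
    intro i
    have hV0 := hVpos (i : E) (hs_pos i)
    have h := (hm_abs_mul i).trans (hIQ_le i)
    rw [show α * (4 ^ n * V i (s i)) = (4 ^ n * α) * V i (s i) by ring] at h
    exact le_of_mul_le_mul_right h hV0
  /- the good part off `f·1_{Ωᶜ}`: `G = Σ m_i 1_{B_i}` (at most one non-zero term) -/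
  set G : E → ℝ := fun x => ∑' i, (B i).indicator (fun _ => m i) x with hG
  have hGmeas : Measurable G := Measurable.tsum fun i => measurable_const.indicator (hBmeas i)
  have hG_of_mem : ∀ {x : E} {i : u}, x ∈ B i → G x = m i := by
    intro x i hxi
    have hoff : ∀ i' : u, i' ≠ i → x ∉ B i' := fun i' hi' hx' => hi' (hB_unique hx' hxi)
    simp only [hG]
    rw [tsum_eq_single i (fun i' hi' => indicator_of_notMem (hoff i' hi') _), indicator_of_mem hxi]
  have hG_of_notMem : ∀ {x : E}, x ∉ UB → G x = 0 := by
    intro x hx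
    have hoff : ∀ i : u, x ∉ B i := fun i hi => hx (mem_iUnion.2 ⟨i, hi⟩)
    simp only [hG]
    rw [show (fun i : u => (B i).indicator (fun _ => m i) x) = fun _ => 0 from
      funext fun i => indicator_of_notMem (hoff i) _, tsum_zero]
  have hG_abs : ∀ x, |G x| ≤ 4 ^ n * α := by
    intro x
    by_cases hx : x ∈ UB
    · obtain ⟨i, hi⟩ := mem_iUnion.1 hx
      rw [hG_of_mem hi]
      exact hm_abs i
    · rw [hG_of_notMem hx, abs_zero]
      positivity
  have hG_enorm : ∀ x, ‖G x‖ₑ = ∑' i, (B i).indicator (fun _ => ‖m i‖ₑ) x := by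
    intro x
    by_cases hx : x ∈ UB
    · obtain ⟨i, hi⟩ := mem_iUnion.1 hx
      have hoff : ∀ i' : u, i' ≠ i → x ∉ B i' := fun i' hi' hx' => hi' (hB_unique hx' hi)
      rw [hG_of_mem hi, tsum_eq_single i (fun i' hi' => indicator_of_notMem (hoff i' hi') _),
        indicator_of_mem hi]
    · have hoff : ∀ i : u, x ∉ B i := fun i hi => hx (mem_iUnion.2 ⟨i, hi⟩)
      rw [hG_of_notMem hx, enorm_zero,
        show (fun i : u => (B i).indicator (fun _ => ‖m i‖ₑ) x) = fun _ => 0 from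
          funext fun i => indicator_of_notMem (hoff i) _, tsum_zero]
  /- the pieces -/
  set g : E → ℝ := fun x => Ωᶜ.indicator f x + G x with hg
  set b : u → E → ℝ := fun i x => (Q i).indicator f x - (B i).indicator (fun _ => m i) x with hb
  have hg_of_mem : ∀ {x : E}, x ∈ Ω → g x = G x := fun hx => by
    simp only [hg, indicator_of_notMem (show _ ∉ Ωᶜ from fun h => h hx), zero_add]
  have hg_of_notMem : ∀ {x : E}, x ∉ Ω → g x = f x := fun hx => by
    simp only [hg, indicator_of_mem (show _ ∈ Ωᶜ from hx), hG_of_notMem (fun h => hx (hUB_sub_Ω h)),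
      add_zero]
  have hgmeas : Measurable g := (hfm.indicator hΩmeas.compl).add hGmeas
  have hbmeas : ∀ i, Measurable (b i) := fun i =>
    (hfm.indicator (hQmeas i)).sub (measurable_const.indicator (hBmeas i))
  have hb_supp : ∀ i, support (b i) ⊆ Q i := by
    intro i x hx
    by_contra hxQ
    refine hx ?_
    simp only [hb, indicator_of_notMem hxQ, indicator_of_notMem (fun h => hxQ (hB_sub_Q i h)), sub_zero]
  /- `ENNReal` bookkeeping: `‖m i‖ₑ μ(B i) ≤ ∫⁻_{Q i} ‖f‖ₑ` and `α μ(B i) ≤ ∫⁻_{B i} ‖f‖ₑ` -/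
  have hlint_abs : ∀ S : Set E, ENNReal.ofReal (∫ y in S, |f y| ∂μ) = ∫⁻ y in S, ‖f y‖ₑ ∂μ := by
    intro S
    rw [← ofReal_integral_norm_eq_lintegral_enorm hfi.integrableOn]
    rfl
  have hV_ofReal : ∀ i : u, ENNReal.ofReal (V (i : E) (s i)) = μ (B i) := fun i =>
    ofReal_measureReal measure_closedBall_lt_top.ne
  have hmB_le : ∀ i, ‖m i‖ₑ * μ (B i) ≤ ∫⁻ y in Q i, ‖f y‖ₑ ∂μ := by
    intro i
    rw [← hV_ofReal, Real.enorm_eq_ofReal_abs, ← ENNReal.ofReal_mul (abs_nonneg _), ← hlint_abs]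
    exact ENNReal.ofReal_le_ofReal (hm_abs_mul i)
  have hαB_le : ∀ i, ENNReal.ofReal α * μ (B i) ≤ ∫⁻ y in B i, ‖f y‖ₑ ∂μ := by
    intro i
    rw [← hV_ofReal, ← ENNReal.ofReal_mul hα.le, ← hlint_abs]
    exact ENNReal.ofReal_le_ofReal (hB_lower i).le
  have hsumQ : ∑' i, ∫⁻ y in Q i, ‖f y‖ₑ ∂μ ≤ ∫⁻ y, ‖f y‖ₑ ∂μ := by
    rw [← lintegral_iUnion hQmeas hQdisj]
    exact setLIntegral_le_lintegral _ _
  refine ⟨u, inferInstance, fun i => (i : E), fun i => s i, g, b, fun i => hs_pos i, ?_, hgmeas, ?_, ?_,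
    ?_, ?_, ?_, hbmeas, ?_, fun i => (hb_supp i).trans (hQ_sub_Bs i), ?_, ?_, ?_⟩
  · -- `Σ μ(B i) ≤ α⁻¹ ‖f‖₁`
    rw [← ENNReal.mul_le_iff_le_inv (ENNReal.ofReal_pos.2 hα).ne' ENNReal.ofReal_ne_top,
      ← ENNReal.tsum_mul_left]
    calc ∑' i, ENNReal.ofReal α * μ (B i) ≤ ∑' i, ∫⁻ y in B i, ‖f y‖ₑ ∂μ := ENNReal.tsum_le_tsum hαB_le
      _ = ∫⁻ y in UB, ‖f y‖ₑ ∂μ := (lintegral_iUnion hBmeas hBdisj _).symm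
      _ ≤ ∫⁻ y, ‖f y‖ₑ ∂μ := setLIntegral_le_lintegral _ _
  · -- `g` integrable (from the `L¹` bound proved below, repeated here)
    refine ⟨hgmeas.aestronglyMeasurable, ?_⟩
    have h1 : ∫⁻ x, ‖g x‖ₑ ∂μ ≤ ∫⁻ x, ‖G x‖ₑ ∂μ + ∫⁻ x, ‖Ωᶜ.indicator f x‖ₑ ∂μ := by
      rw [← lintegral_add_left hGmeas.enorm]
      refine lintegral_mono fun x => ?_
      simp only [hg]
      rw [add_comm]
      exact enorm_add_le _ _
    have h2 : ∫⁻ x, ‖G x‖ₑ ∂μ ≤ ∫⁻ y, ‖f y‖ₑ ∂μ := by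
      calc ∫⁻ x, ‖G x‖ₑ ∂μ = ∫⁻ x, ∑' i, (B i).indicator (fun _ => ‖m i‖ₑ) x ∂μ :=
            lintegral_congr fun x => hG_enorm x
        _ = ∑' i, ∫⁻ x, (B i).indicator (fun _ => ‖m i‖ₑ) x ∂μ :=
            lintegral_tsum fun i => (measurable_const.indicator (hBmeas i)).aemeasurable
        _ = ∑' i, ‖m i‖ₑ * μ (B i) := by
            refine tsum_congr fun i => ?_
            rw [lintegral_indicator_const (hBmeas i)]
        _ ≤ ∑' i, ∫⁻ y in Q i, ‖f y‖ₑ ∂μ := ENNReal.tsum_le_tsum hmB_le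
        _ ≤ _ := hsumQ
    have h3 : ∫⁻ x, ‖Ωᶜ.indicator f x‖ₑ ∂μ ≤ ∫⁻ y, ‖f y‖ₑ ∂μ :=
      lintegral_mono fun x => enorm_indicator_le_enorm_self _ _
    exact lt_of_le_of_lt (h1.trans (add_le_add h2 h3)) (ENNReal.add_lt_top.2
      ⟨hfi.hasFiniteIntegral, hfi.hasFiniteIntegral⟩)
  · -- `|g| ≤ 4ⁿ α` a.e.
    filter_upwards [hlevel] with x hx
    by_cases hxΩ : x ∈ Ω
    · rw [hg_of_mem hxΩ]; exact hG_abs x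
    · rw [hg_of_notMem hxΩ]
      refine (hx hxΩ).trans ?_
      have : (1 : ℝ) ≤ 4 ^ n := one_le_pow₀ (by norm_num)
      nlinarith
  · -- `|g| ≤ max |f| (4ⁿ α)` everywhere
    intro x
    by_cases hxΩ : x ∈ Ω
    · rw [hg_of_mem hxΩ]; exact (hG_abs x).trans (le_max_right _ _)
    · rw [hg_of_notMem hxΩ]; exact le_max_left _ _
  · -- `‖g‖₁ ≤ ‖f‖₁`
    have h1 : ∫⁻ x, ‖g x‖ₑ ∂μ ≤ ∫⁻ x, ‖G x‖ₑ ∂μ + ∫⁻ x, ‖Ωᶜ.indicator f x‖ₑ ∂μ := by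
      rw [← lintegral_add_left hGmeas.enorm]
      refine lintegral_mono fun x => ?_
      simp only [hg]
      rw [add_comm]
      exact enorm_add_le _ _
    have h2 : ∫⁻ x, ‖G x‖ₑ ∂μ ≤ ∫⁻ y in Ω, ‖f y‖ₑ ∂μ := by
      calc ∫⁻ x, ‖G x‖ₑ ∂μ = ∫⁻ x, ∑' i, (B i).indicator (fun _ => ‖m i‖ₑ) x ∂μ :=
            lintegral_congr fun x => hG_enorm x
        _ = ∑' i, ∫⁻ x, (B i).indicator (fun _ => ‖m i‖ₑ) x ∂μ :=
            lintegral_tsum fun i => (measurable_const.indicator (hBmeas i)).aemeasurable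
        _ = ∑' i, ‖m i‖ₑ * μ (B i) := by
            refine tsum_congr fun i => ?_
            rw [lintegral_indicator_const (hBmeas i)]
        _ ≤ ∑' i, ∫⁻ y in Q i, ‖f y‖ₑ ∂μ := ENNReal.tsum_le_tsum hmB_le
        _ = ∫⁻ y in Ω, ‖f y‖ₑ ∂μ := by rw [← lintegral_iUnion hQmeas hQdisj, hQunion]
    have h3 : ∫⁻ x, ‖Ωᶜ.indicator f x‖ₑ ∂μ = ∫⁻ y in Ωᶜ, ‖f y‖ₑ ∂μ := by
      rw [← lintegral_indicator hΩmeas.compl]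
      exact lintegral_congr fun x => enorm_indicator_eq_indicator_enorm _ _
    calc ∫⁻ x, ‖g x‖ₑ ∂μ ≤ ∫⁻ y in Ω, ‖f y‖ₑ ∂μ + ∫⁻ y in Ωᶜ, ‖f y‖ₑ ∂μ := by
          rw [← h3]; exact h1.trans (add_le_add h2 le_rfl)
      _ = ∫⁻ y, ‖f y‖ₑ ∂μ := lintegral_add_compl _ hΩmeas
  · -- compact support is inherited
    intro hfc
    obtain ⟨Rf, hRf⟩ : ∃ Rf : ℝ, tsupport f ⊆ closedBall (0 : E) Rf :=
      hfc.isCompact.isBounded.subset_closedBall 0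
    refine HasCompactSupport.intro (isCompact_closedBall (0 : E) (Rf + 5 * R₀)) fun x hx => ?_
    rw [mem_closedBall_zero_iff, not_le] at hx
    have hfx : ∀ y : E, Rf < ‖y‖ → f y = 0 := fun y hy =>
      image_eq_zero_of_notMem_tsupport fun h => (not_le.2 hy) (mem_closedBall_zero_iff.1 (hRf h))
    by_cases hxΩ : x ∈ Ω
    · -- every enlarged ball lies in `B̄(0, Rf + 5R₀)`: contradiction
      exfalso
      obtain ⟨i, hi⟩ := mem_iUnion.1 hxΩ
      -- the stopping ball `B i` meets the support of `f`
      have hpos : 0 < I i (s i) := lt_of_le_of_lt (by positivity) (hB_lower i)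
      have hmeet : ∃ y ∈ B i, f y ≠ 0 := by
        by_contra hnone
        simp only [not_exists, not_and, not_not] at hnone
        have : I i (s i) = 0 := by
          simp only [hI]
          exact setIntegral_eq_zero_of_forall_eq_zero fun y hy => by rw [hnone y hy, abs_zero]
        exact hpos.ne' this
      obtain ⟨y, hyB, hyf⟩ := hmeet
      have hy : ‖y‖ ≤ Rf := le_of_not_gt fun h => hyf (hfx y h)
      have hyi : dist y (i : E) ≤ s i := mem_closedBall.1 hyB
      have hxi : dist x (i : E) ≤ 4 * s i := mem_closedBall.1 hi
      have hsi : s i ≤ R₀ / 2 := hs_le i (hit i)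
      have : ‖x‖ ≤ Rf + 5 * R₀ := by
        have h1 : ‖x‖ ≤ dist x (i : E) + dist (i : E) y + ‖y‖ := by
          calc ‖x‖ = dist x 0 := (dist_zero_right x).symm
            _ ≤ dist x (i : E) + dist (i : E) y + dist y 0 := dist_triangle4 x i y 0
            _ = _ := by rw [dist_zero_right]
        rw [dist_comm (i : E) y] at h1
        linarith
      linarith
    · rw [hg_of_notMem hxΩ]
      exact hfx x (by linarith [hR₀])
  · -- `b i` integrable
    intro i
    refine Integrable.sub (hfi.indicator (hQmeas i)) ?_
    exact (integrableOn_const (show μ (B i) ≠ ⊤ from measure_closedBall_lt_top.ne)).integrable_indicator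
      (hBmeas i)
  · -- mean zero
    intro i
    have hV0 := hVpos (i : E) (hs_pos i)
    have hint1 : Integrable ((Q i).indicator f) μ := hfi.indicator (hQmeas i)
    have hint2 : Integrable ((B i).indicator fun _ => m i) μ :=
      (integrableOn_const (show μ (B i) ≠ ⊤ from measure_closedBall_lt_top.ne)).integrable_indicator
        (hBmeas i)
    simp only [hb]
    rw [integral_sub hint1 hint2, integral_indicator (hQmeas i), integral_indicator (hBmeas i),
      setIntegral_const, smul_eq_mul]
    simp only [hm]
    rw [show μ.real (B i) = V i (s i) from rfl]
    field_simp
    ring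
  · -- `Σ ‖b i‖₁ ≤ 2 ‖f‖₁`
    have hbi : ∀ i, ∫⁻ x, ‖b i x‖ₑ ∂μ ≤ 2 * ∫⁻ y in Q i, ‖f y‖ₑ ∂μ := by
      intro i
      calc ∫⁻ x, ‖b i x‖ₑ ∂μ
          ≤ ∫⁻ x, ‖(Q i).indicator f x‖ₑ ∂μ + ∫⁻ x, ‖(B i).indicator (fun _ => m i) x‖ₑ ∂μ := by
            rw [← lintegral_add_left ((hfm.indicator (hQmeas i)).enorm)]
            exact lintegral_mono fun x => enorm_sub_le
        _ = ∫⁻ y in Q i, ‖f y‖ₑ ∂μ + ‖m i‖ₑ * μ (B i) := by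
            congr 1
            · rw [← lintegral_indicator (hQmeas i)]
              exact lintegral_congr fun x => enorm_indicator_eq_indicator_enorm _ _
            · rw [← lintegral_indicator_const (hBmeas i)]
              exact lintegral_congr fun x => enorm_indicator_eq_indicator_enorm _ _
        _ ≤ ∫⁻ y in Q i, ‖f y‖ₑ ∂μ + ∫⁻ y in Q i, ‖f y‖ₑ ∂μ := add_le_add le_rfl (hmB_le i)
        _ = 2 * ∫⁻ y in Q i, ‖f y‖ₑ ∂μ := by rw [two_mul]
    calc ∑' i, ∫⁻ x, ‖b i x‖ₑ ∂μ ≤ ∑' i, 2 * ∫⁻ y in Q i, ‖f y‖ₑ ∂μ := ENNReal.tsum_le_tsum hbi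
      _ = 2 * ∑' i, ∫⁻ y in Q i, ‖f y‖ₑ ∂μ := ENNReal.tsum_mul_left
      _ ≤ 2 * ∫⁻ y, ‖f y‖ₑ ∂μ := by gcongr
  · -- `f - g = Σ b i` pointwise
    intro x
    by_cases hxΩ : x ∈ Ω
    · have hxQ : x ∈ ⋃ i, Q i := by rw [hQunion]; exact hxΩ
      obtain ⟨i, hi⟩ := mem_iUnion.1 hxQ
      have hoff : ∀ i' : u, i' ≠ i → b i' x = 0 := fun i' hi' =>
        notMem_support.1 fun h => hi' (hQ_unique (hb_supp i' h) hi)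
      have hval : b i x = f x - g x := by
        rw [hg_of_mem hxΩ]
        simp only [hb, indicator_of_mem hi]
        by_cases hxB : x ∈ B i
        · rw [indicator_of_mem hxB, hG_of_mem hxB]
        · rw [indicator_of_notMem hxB, hG_of_notMem fun h => ?_]
          obtain ⟨i', hi'⟩ := mem_iUnion.1 h
          exact hxB ((hQ_unique (hB_sub_Q i' hi') hi) ▸ hi')
      rw [← hval]
      exact hasSum_single i hoff
    · have hzero : ∀ i : u, b i x = 0 := fun i =>
        notMem_support.1 fun h => hxΩ (hQunion ▸ mem_iUnion.2 ⟨i, hb_supp i h⟩)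
      rw [hg_of_notMem hxΩ, sub_self, show (fun i => b i x) = fun _ => 0 from funext hzero]
      exact hasSum_zero

end Literature.Analysis.SingularIntegrals
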